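import Mathlib
import Literature.Combinatorics.Additive.SumsetsInRootsOfUnityBound

/-!
# Crux `FeketeSOS.CharPSparseSOS` (stmt-ValiantsHypothesis-14989) — what the polynomial method gives on the
sum-clique core (CORE)

Every line on this crux reduces it (kernel-checked, `rQ_far_from_QR_of_charPSparseSOS`, p112874) to
(CORE): *a weak-Sidon Paley SUM-clique `Q ⊂ 𝔽_p` — restricted sums `a + b`, `a ≠ b`, pairwise distinct and all
non-zero quadratic residues — has `|Q| ≤ √p − p^δ/2 + 9`*, against the counting bound `|Q| ≤ √p + 1`.  The only
tool below the completion estimate for sumsets inside the quadratic residues is Stepanov's method in the form of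
Hanson–Petridis 2021 (`Literature.Combinatorics.Additive.HansonPetridis`), which needs FULL sumsets.  This file
records exactly what it yields for RESTRICTED sum-cliques (lead c3's on-paper remarks, lead c4 kernel-check):

* `sumClique_card_mul_card_good_le` — with `Q⁺ = {a ∈ Q : 2a ∈ QR}` (the points whose diagonal is good) the pair
  `(A, B) = (Q⁺, Q)` has `A + B ⊆ QR` on the nose and `B ∩ (−A) = ∅`, so **`|Q| · |Q⁺| ≤ (p − 1)/2`**
  (no Sidon hypothesis needed);
* `legendreSym_val_eq_of_diag` — the complementary class `Q⁻ = Q ∖ Q⁺ ∖ {0}` lies inside ONE quadratic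
  class: `(a|p) = −(2|p)` on `Q⁻` (and `(a|p) = (2|p)` on `Q⁺`);
* `sumClique_card_mul_card_add_le_of_good_majority` — hence **(CORE) holds off the anti-diagonal class**: if
  `2|Q⁺| ≥ |Q| + t` then `|Q| (|Q| + t) ≤ p − 1`, i.e. `|Q| ≤ √p − t/2 + O(1)`; in particular a sum-clique with
  `|Q⁺| ≥ |Q⁻|` already has `|Q| ≤ √(p − 1)` (`sumClique_card_le_sqrt_of_good_majority`), one notch below counting,
  and `t = p^δ` gives CORE's conclusion.

So the residual hard configuration of (CORE) — and therefore of the crux — is a near-counting-extremal weak-Sidon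
sum-clique with `|Q⁻| > |Q|/2`, `Q⁻` inside the quadratic class `−(2|p)`, where the diagonal `2a ∉ QR` defeats the
auxiliary polynomial (lead c3, `Cruxes/CharPSparseSOS/Lines/Sketch-dead-c3.md` §3: curing the diagonal by
multipliers is tight exactly at the counting bound).  Nothing here uses the Sidon hypothesis: the statements are
about Paley sum-graph cliques with a free diagonal.
-/

-- `Summit.ValiantsHypothesis.ValiantsHypothesis.…` is the tree's mandated single-conjunct layout (Sub = Summit).
set_option linter.dupNamespace false

namespace Summit.ValiantsHypothesis.ValiantsHypothesis.Theorems.CharPSparseSOSTwoCusp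

open Finset
open Literature.Combinatorics.Additive.HansonPetridis

/-! ## Euler's criterion in the `legendreSym p x.val` vocabulary of the crux notes -/

/-- If `(x|p) = 1` (Legendre symbol of the representative `x.val`) then `x ^ ((p−1)/2) = 1` in `𝔽_p`
(Euler's criterion, `legendreSym.eq_pow`). -/
theorem pow_div_two_eq_one_of_legendreSym_val {p : ℕ} [Fact p.Prime] (x : ZMod p)
    (h : legendreSym p x.val = 1) : x ^ (p / 2) = 1 := by
  have h1 := legendreSym.eq_pow p (x.val : ℤ)
  rw [h, Int.cast_one, Int.cast_natCast, ZMod.natCast_zmod_val] at h1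
  exact h1.symm

/-- If `(x|p) = 1` then `x ≠ 0` in `𝔽_p`. -/
theorem ne_zero_of_legendreSym_val {p : ℕ} [Fact p.Prime] (x : ZMod p)
    (h : legendreSym p x.val = 1) : x ≠ 0 := by
  intro hx
  rw [hx, ZMod.val_zero, Nat.cast_zero, legendreSym.at_zero] at h
  exact zero_ne_one h

/-! ## The Hanson–Petridis pairing `(Q⁺, Q)` for a restricted sum-clique -/

/-- **`|Q| · |Q⁺| ≤ (p − 1)/2` for restricted Paley sum-cliques.**  Let `p` be an odd prime and `Q ⊆ 𝔽_p` a
restricted sum-clique: `(a + b | p) = 1` for all `a ≠ b` in `Q` (the diagonal `2a` is free).  With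
`Q⁺ = {a ∈ Q : (2a|p) = 1}`, the pair `(Q⁺, Q)` has full sumset inside the non-zero quadratic residues and no
pair summing to `0`, so Hanson–Petridis gives `|Q⁺| · |Q| ≤ (p − 1)/2`.  (Lead c3/c4 of crux
stmt-ValiantsHypothesis-14989; no Sidon hypothesis is used.) -/
theorem sumClique_card_mul_card_good_le :
    ∀ (p : ℕ) [Fact p.Prime], p ≠ 2 → ∀ Q : Finset (ZMod p),
      (∀ a ∈ Q, ∀ b ∈ Q, a ≠ b → legendreSym p (a + b).val = 1) →
      (Q.filter (fun a => legendreSym p (a + a).val = 1)).card * Q.card ≤ p / 2 := by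
  intro p hp hp2 Q hclique
  classical
  set Qp := Q.filter fun a => legendreSym p (a + a).val = 1 with hQp
  have hsum : ∀ a ∈ Qp, ∀ b ∈ Q, a + b = 0 ∨ (a + b) ^ (p / 2) = 1 := by
    intro a ha b hb
    rw [hQp, mem_filter] at ha
    right
    by_cases hab : a = b
    · subst hab
      exact pow_div_two_eq_one_of_legendreSym_val _ ha.2
    · exact pow_div_two_eq_one_of_legendreSym_val _ (hclique a ha.1 b hb hab)
  have h := card_mul_card_le_of_sumset_subset_quadraticResidues hp2 Qp Q hsum
  have hempty : (Q.filter fun b => -b ∈ Qp) = ∅ := by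
    rw [Finset.filter_eq_empty_iff]
    intro b hb hbA
    rw [hQp, mem_filter] at hbA
    by_cases hbb : -b = b
    · -- then `2b = 0`, contradicting `(2(−b)|p) = 1`
      have h0 : -b + -b = 0 := by
        nth_rewrite 2 [hbb]
        exact neg_add_cancel b
      exact ne_zero_of_legendreSym_val _ hbA.2 h0
    · have h1 := hclique (-b) hbA.1 b hb hbb
      exact ne_zero_of_legendreSym_val _ h1 (neg_add_cancel b)
  rw [hempty, card_empty, add_zero] at h
  exact h

/-- The Legendre symbol of the representative `x.val` is the quadratic character of `x`. -/
theorem legendreSym_val_eq_quadraticChar {p : ℕ} [Fact p.Prime] (x : ZMod p) :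
    legendreSym p x.val = quadraticChar (ZMod p) x := by
  rw [legendreSym, Int.cast_natCast, ZMod.natCast_zmod_val]

/-- **The anti-diagonal class.**  In a restricted sum-clique the Legendre symbol is multiplicative on the
diagonal: a point `a ≠ 0` with bad diagonal (`(2a|p) ≠ 1`) has `(a|p) = −(2|p)`, and one with good diagonal
has `(a|p) = (2|p)`; so `Q⁻ ∖ {0}` and `Q⁺` each lie inside ONE quadratic class (lead c3). -/
theorem legendreSym_val_eq_of_diag {p : ℕ} [hp : Fact p.Prime] (hp2 : p ≠ 2) (a : ZMod p) (ha0 : a ≠ 0) :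
    (legendreSym p (a + a).val = 1 → legendreSym p a.val = legendreSym p 2) ∧
    (legendreSym p (a + a).val ≠ 1 → legendreSym p a.val = -legendreSym p 2) := by
  have htwo : (2 : ZMod p) ≠ 0 := by
    intro h
    have h' : ((2 : ℕ) : ZMod p) = 0 := by exact_mod_cast h
    rw [ZMod.natCast_eq_zero_iff] at h'
    exact hp2 ((Nat.prime_dvd_prime_iff_eq hp.out Nat.prime_two).mp h')
  have h2 : legendreSym p 2 = quadraticChar (ZMod p) 2 := by
    rw [legendreSym, Int.cast_ofNat]
  rw [legendreSym_val_eq_quadraticChar, legendreSym_val_eq_quadraticChar, h2, ← two_mul, map_mul]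
  rcases quadraticChar_dichotomy htwo with h | h <;>
    rcases quadraticChar_dichotomy ha0 with h' | h' <;> norm_num [h, h']

/-! ## (CORE) off the anti-diagonal class -/

/-- **(CORE) holds when the good class has the (weak) majority, quantitatively.**  For an odd prime `p` and a
restricted Paley sum-clique `Q ⊆ 𝔽_p`, if `2 |Q⁺| ≥ |Q| + t` then `|Q| · (|Q| + t) ≤ p − 1`; with `t = p^δ`
this is `|Q| ≤ √p − p^δ/2 + O(1)`, the conclusion of (CORE), WITHOUT the Sidon hypothesis.  The hard
configuration of (CORE) is therefore `|Q⁻| > |Q|/2 − p^δ/2`. -/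
theorem sumClique_card_mul_card_add_le_of_good_majority :
    ∀ (p : ℕ) [Fact p.Prime], p ≠ 2 → ∀ (Q : Finset (ZMod p)) (t : ℕ),
      (∀ a ∈ Q, ∀ b ∈ Q, a ≠ b → legendreSym p (a + b).val = 1) →
      Q.card + t ≤ 2 * (Q.filter (fun a => legendreSym p (a + a).val = 1)).card →
      Q.card * (Q.card + t) ≤ p - 1 := by
  intro p hp hp2 Q t hclique hmaj
  have h := sumClique_card_mul_card_good_le p hp2 Q hclique
  have hodd : p % 2 = 1 := Nat.odd_iff.mp (hp.out.odd_of_ne_two hp2)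
  have h2 : 2 * (p / 2) = p - 1 := by omega
  calc Q.card * (Q.card + t)
      ≤ Q.card * (2 * (Q.filter fun a => legendreSym p (a + a).val = 1).card) :=
        Nat.mul_le_mul_left _ hmaj
    _ = 2 * ((Q.filter fun a => legendreSym p (a + a).val = 1).card * Q.card) := by ring
    _ ≤ 2 * (p / 2) := Nat.mul_le_mul_left _ h
    _ = p - 1 := h2

/-- **One notch below counting for balanced sum-cliques.**  A restricted Paley sum-clique with at least as many
good-diagonal points as others (`2|Q⁺| ≥ |Q|`) has `|Q| ≤ √(p − 1)` — below the counting bound `√p + 1/2` of the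
weak-Sidon case, with no Sidon hypothesis. -/
theorem sumClique_card_le_sqrt_of_good_majority {p : ℕ} [hp : Fact p.Prime] (hp2 : p ≠ 2)
    (Q : Finset (ZMod p)) (hclique : ∀ a ∈ Q, ∀ b ∈ Q, a ≠ b → legendreSym p (a + b).val = 1)
    (hmaj : Q.card ≤ 2 * (Q.filter fun a => legendreSym p (a + a).val = 1).card) :
    (Q.card : ℝ) ≤ Real.sqrt (p - 1) := by
  have h := sumClique_card_mul_card_add_le_of_good_majority p hp2 Q 0 hclique (by rw [add_zero]; exact hmaj)
  rw [add_zero] at h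
  have hp1 : 1 ≤ p := hp.out.one_le
  have hcast : ((Q.card : ℝ)) ^ 2 ≤ (p : ℝ) - 1 := by
    have : ((Q.card * Q.card : ℕ) : ℝ) ≤ ((p - 1 : ℕ) : ℝ) := by exact_mod_cast h
    push_cast [Nat.cast_sub hp1] at this
    rw [sq]
    exact this
  calc (Q.card : ℝ) = Real.sqrt ((Q.card : ℝ) ^ 2) := by
        rw [Real.sqrt_sq (Nat.cast_nonneg _)]
    _ ≤ Real.sqrt (p - 1) := Real.sqrt_le_sqrt hcast

/-- **The fully good case.**  If every point of the restricted sum-clique has a good diagonal (`Q⁺ = Q`, e.g.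
`Q ⊆ QR` when `(2|p) = 1`), then `|Q|² ≤ (p − 1)/2`: such cliques are smaller than `√(p/2) + 1`, far inside
(CORE). -/
theorem sumClique_card_sq_le_of_all_good {p : ℕ} [hp : Fact p.Prime] (hp2 : p ≠ 2)
    (Q : Finset (ZMod p)) (hclique : ∀ a ∈ Q, ∀ b ∈ Q, a ≠ b → legendreSym p (a + b).val = 1)
    (hgood : ∀ a ∈ Q, legendreSym p (a + a).val = 1) :
    Q.card * Q.card ≤ p / 2 := by
  have h := sumClique_card_mul_card_good_le p hp2 Q hclique
  rwa [Finset.filter_true_of_mem hgood] at h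

end Summit.ValiantsHypothesis.ValiantsHypothesis.Theorems.CharPSparseSOSTwoCusp
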